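import Literature.Barriers.Parity.SiegelZeroDichotomyPairHLProp81Pointwise
import Literature.Barriers.Parity.SiegelZeroDichotomyPairHLLocalBridge
import HarnessLib

/-!
# Tao–Teräväinen 2022, §8 (`k = 2`): the pointwise bound (8.8) in the bulk, from the Euler-product asymptotic

Topic `Literature/Barriers/Parity`, sub-namespace `TaoTeravainen`; assembly step of (8.8) in the proof DAG
of `Literature.Barriers.Parity.TaoTeravainen2021_prop72_81_pair` (T. Tao, J. Teräväinen, *The
Hardy–Littlewood–Chowla conjecture in the presence of a Siegel zero*, J. London Math. Soc. (2) 106 (2022),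
arXiv:2109.06291), §8 (8.8), (8.17), (8.25). Everything here is PROVED. This file instantiates the
abstract assembly `norm_integral_kernel_sub_le` (`…Prop81Pointwise.lean`) at a bulk point `y`:
`G(y) = ∫ K W` (`smoothPointwise_eq_integral`), `K = ∏_{p<N} E_p` (`sixKernel_eq_prod`,
`sixLocalFactor_eq_localE`), the two Möbius slots are `1 + O(…)` (`…MoebiusSlot.lean`), and the
Euler-product asymptotic `‖∏_{p<N} E_p(τ) − 𝔖' ∏_j ∏_{p<N}(1 − p^{-s(τ_{j,0})})‖ ≤ err(τ)` enters as the
hypothesis `hK` (the subject of the `…MainTermLocal*.lean` files):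

* `integrable_sixKernel_mul_sixWeight`, `sixKernel_eq_prod_localE`;
* **`norm_smoothPointwise_sub_le`** — `‖G(y) − 𝔖'‖ ≤ ε_K + ‖𝔖'‖ (2ε + ε²)` with the explicit Möbius-slot
  error `ε` of `norm_integral_psiFourier_eulerTrunc_sub_one_le`. [cite: TaoTeravainen2021, §8 (8.8), (8.25)]
-/

noncomputable section

open Finset Real MeasureTheory Complex
open scoped FourierTransform

namespace Literature.Barriers.Parity

namespace TaoTeravainen

variable {q : ℕ}

/-- The Möbius-slot error `ε` of `norm_integral_psiFourier_eulerTrunc_sub_one_le`: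
`2τ₀ S_g 2C₀(1/X + 2πτ₀)² + 7(X+2) D_n (1+U₀τ₀)³/(1+U₀τ₀)ⁿ · π/U₀`. [cite: TaoTeravainen2021, §8 (8.25)] -/
def moebiusSlotErr (M : ℕ → ℝ) (X U₀ C₀ τ₀ : ℝ) (n : ℕ) : ℝ :=
  2 * τ₀ * (6 * Real.exp 1 * U₀ * ((X + 2 * U₀) * cutoffDerivSum M 0)) * (2 * C₀ * (X⁻¹ + 2 * π * τ₀) ^ 2) +
    7 * (X + 2) * (2 ^ n * (6 * Real.exp 1) * U₀ * ((1 + n) * (X + 2 * U₀) * cutoffDerivSum M n)) *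
      (1 + U₀ * τ₀) ^ 3 / (1 + U₀ * τ₀) ^ n * (π / U₀)

/-- **`K · W` is integrable** (a finite sum of integrable slot products). [folklore] -/
theorem integrable_sixKernel_mul_sixWeight (χ : DirichletCharacter ℂ q) {φ ψ : ℝ → ℝ}
    (hφ : IsBump φ) (hψ : IsSmoothCutoff ψ) {X U₀ : ℝ} (hU₀ : 1 ≤ U₀) (hX : 2 * U₀ + 2 ≤ X)
    {R : ℝ} (hR : 1 < R) (h₁ h₂ : ℕ) {y : ℝ}
    (hc : ∀ j : Fin 2, Real.log (y + (if j = 0 then h₁ else h₂ : ℕ)) ≤ X + 1) {P : Finset ℕ}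
    (hP : ∀ p ∈ P, p.Prime) (A : ℕ) :
    Integrable fun τ : Slot → ℝ => sixKernel χ X R h₁ h₂ P A τ * sixWeight φ ψ X U₀ h₁ h₂ y τ := by
  have hpos : ∀ n ∈ sixBox P A, ∀ k, 1 ≤ n k := by
    intro n hn k
    obtain ⟨α, -, rfl⟩ := (mem_sixBox_iff).mp hn
    exact decodeBox_pos hP α k
  have hint : ∀ n ∈ sixBox P A, Integrable (fun τ : Slot → ℝ =>
      ((crtDensity h₁ h₂ (slotLcm n 0) (slotLcm n 1) : ℝ) : ℂ) * sixArith χ n *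
        ∏ k : Slot, (npow (slotExpo X R k (τ k)) (n k) * slotTransform φ ψ X U₀ h₁ h₂ y k (τ k))) := by
    intro n hn
    refine Integrable.const_mul ?_ _
    have h : Integrable (fun τ : Slot → ℝ => ∏ k : Slot,
        (npow (slotExpo X R k (τ k)) (n k) * slotTransform φ ψ X U₀ h₁ h₂ y k (τ k)))
        (Measure.pi fun _ : Slot => (volume : Measure ℝ)) :=
      Integrable.fintype_prod (f := fun k τ => npow (slotExpo X R k τ) (n k) * slotTransform φ ψ X U₀ h₁ h₂ y k τ)
        fun k => integrable_slot hφ hψ hU₀ hX hR h₁ h₂ hc k (hpos n hn k)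
    rwa [← volume_pi] at h
  have h := integrable_finsetSum (sixBox P A) hint
  refine h.congr (ae_of_all _ fun τ => ?_)
  beta_reduce
  unfold sixKernel sixWeight
  rw [sum_mul]
  refine sum_congr rfl fun n _ => ?_
  rw [prod_mul_distrib]
  ring

/-- **`K(τ) = ∏_{p ∈ P} E_p(τ)` in the main term's variables** (`χ` quadratic, `h₁ ≠ h₂`, `A ≥ 1`).
[cite: TaoTeravainen2021, §8 (8.17)–(8.19)] -/
theorem sixKernel_eq_prod_localE (χ : DirichletCharacter ℂ q) (hχ : χ.IsQuadratic) (X R : ℝ) {h₁ h₂ : ℕ}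
    (hne : h₁ ≠ h₂) {P : Finset ℕ} (hP : ∀ p ∈ P, p.Prime) {A : ℕ} (hA : 1 ≤ A) (τ : Slot → ℝ) :
    sixKernel χ X R h₁ h₂ P A τ =
      ∏ p ∈ P, MainTerm.localE p ((shiftDiff h₁ h₂).factorization p) A (realChar χ p)
        (fun j => npow (slotExpo X R (j, 0) (τ (j, 0))) p)
        (fun j => npow (slotExpo X R (j, 1) (τ (j, 1))) p)
        (fun j => npow (slotExpo X R (j, 2) (τ (j, 2))) p) := by
  rw [sixKernel_eq_prod χ X R hne hP A τ, ← Finset.prod_coe_sort P]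
  exact Fintype.prod_congr _ _ fun p => sixLocalFactor_eq_localE χ hχ X R h₁ h₂ p hA τ

/-- **The pointwise bound (8.8) at a bulk point, from the Euler-product asymptotic.** Hypotheses: the
cutoff data (`|ψ⁽ⁱ⁾| ≤ M_i`, `U₀ ≥ 1`, `2U₀+2 ≤ X`, `3U₀ ≤ X`, `R > 1`), the point (`y > 0`,
`log(y+h_j) ≤ X+1`, the bulk identity `psiLog = id` near `c_j = log(y+h_j)`), the truncations (`N` beyond
`D_max`, `⌈R⌉` and the support of `d ↦ Ψ((y+h_j)/d)`; `1 ≤ A`, `D_max < 2^{A+1}`), the `ζ` data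
(`C₀`, `τ₀`, `n ≥ 3`), and the Euler-product asymptotic `hK` with `∫ err ‖W‖ ≤ ε_K`. Conclusion:
`‖G(y) − 𝔖'‖ ≤ ε_K + ‖𝔖'‖ (2ε + ε²)`, `ε` the Möbius-slot error. [cite: TaoTeravainen2021, §8 (8.8), (8.25)] -/
theorem norm_smoothPointwise_sub_le (χ : DirichletCharacter ℂ q) (hχ : χ.IsQuadratic) {φ ψ : ℝ → ℝ}
    (hφ : IsBump φ) (hψ : IsSmoothCutoff ψ) {M : ℕ → ℝ} (hM : ∀ i u, |iteratedDeriv i ψ u| ≤ M i)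
    {X U₀ : ℝ} (hU₀ : 1 ≤ U₀) (hX : 2 * U₀ + 2 ≤ X) (hX3 : 3 * U₀ ≤ X) {R : ℝ} (hR : 1 < R)
    {h₁ h₂ : ℕ} (hne : h₁ ≠ h₂) {y : ℝ} (hy : 0 < y)
    (hc : ∀ j : Fin 2, Real.log (y + (if j = 0 then h₁ else h₂ : ℕ)) ≤ X + 1)
    {δ : ℝ} (hδ : 0 < δ)
    (hbulk₁ : ∀ w ∈ Set.Ioo (Real.log (y + h₁) - δ) (Real.log (y + h₁) + δ), psiLog φ ψ X U₀ w = w)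
    (hbulk₂ : ∀ w ∈ Set.Ioo (Real.log (y + h₂) - δ) (Real.log (y + h₂) + δ), psiLog φ ψ X U₀ w = w)
    {Dmax A N : ℕ} (hA : 1 ≤ A) (hAD : Dmax < 2 ^ (A + 1)) (hN : max Dmax ⌈R⌉₊ < N)
    (hΨ₁ : ∀ d : ℕ, Dmax < d → psiSharp φ ψ X U₀ ((y + h₁) / d) = 0)
    (hΨ₂ : ∀ d : ℕ, Dmax < d → psiSharp φ ψ X U₀ ((y + h₂) / d) = 0)
    {C₀ : ℝ} (hC₀ : 1 ≤ C₀) (hζ₀ : ∀ σ : ℂ, ‖σ‖ ≤ 1 → ‖riemannZeta₀ (1 + σ)‖ ≤ C₀) {τ₀ : ℝ} (hτ₀ : 0 < τ₀)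
    (hsmall : X⁻¹ + 2 * π * τ₀ ≤ 1 / (2 * C₀)) {n : ℕ} (hn : 3 ≤ n)
    {S' : ℂ} {err : (Slot → ℝ) → ℝ} (herrW : Integrable fun τ => err τ * ‖sixWeight φ ψ X U₀ h₁ h₂ y τ‖)
    (hK : ∀ τ : Slot → ℝ,
      ‖(∏ p ∈ Nat.primesBelow N, MainTerm.localE p ((shiftDiff h₁ h₂).factorization p) A (realChar χ p)
          (fun j => npow (slotExpo X R (j, 0) (τ (j, 0))) p)
          (fun j => npow (slotExpo X R (j, 1) (τ (j, 1))) p)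
          (fun j => npow (slotExpo X R (j, 2) (τ (j, 2))) p)) -
        S' * ∏ j : Fin 2, eulerTrunc N (zetaSlotS X (τ (j, 0)))‖ ≤ err τ)
    {εK : ℝ} (hεK : ∫ τ, err τ * ‖sixWeight φ ψ X U₀ h₁ h₂ y τ‖ ≤ εK) :
    ‖((smoothPointwise χ φ ψ X U₀ R h₁ h₂ Dmax y : ℝ) : ℂ) - S'‖ ≤
      εK + ‖S'‖ * (2 * moebiusSlotErr M X U₀ C₀ τ₀ n + moebiusSlotErr M X U₀ C₀ τ₀ n ^ 2) := by
  have hP : ∀ p ∈ Nat.primesBelow N, p.Prime := fun p hp => Nat.prime_of_mem_primesBelow hp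
  have hPD : ∀ p : ℕ, p.Prime → p ≤ max Dmax ⌈R⌉₊ → p ∈ Nat.primesBelow N := fun p hp hle =>
    Nat.mem_primesBelow.mpr ⟨lt_of_le_of_lt hle hN, hp⟩
  rw [smoothPointwise_eq_integral χ hχ hφ hψ hU₀ hX hX3 hR h₁ h₂ hy hc hP hPD hAD hΨ₁ hΨ₂]
  have hKW := integrable_sixKernel_mul_sixWeight χ hφ hψ hU₀ hX hR h₁ h₂ hc hP A
  have hK' : ∀ τ : Slot → ℝ, ‖sixKernel χ X R h₁ h₂ (Nat.primesBelow N) A τ -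
      S' * ∏ j : Fin 2, eulerTrunc N (zetaSlotS X (τ (j, 0)))‖ ≤ err τ := fun τ => by
    rw [sixKernel_eq_prod_localE χ hχ X R hne hP hA τ]; exact hK τ
  -- the Möbius slots
  have hDN : Dmax < N := lt_of_le_of_lt (le_max_left _ _) hN
  have hΨexp : ∀ (h : ℕ), (∀ d : ℕ, Dmax < d → psiSharp φ ψ X U₀ ((y + h) / d) = 0) →
      ∀ d : ℕ, Dmax < d → psiSharp φ ψ X U₀ (Real.exp (Real.log (y + h) - Real.log d)) = 0 := by
    intro h hΨ d hd
    have hd0 : (0 : ℝ) < d := by exact_mod_cast (Nat.zero_le Dmax).trans_lt hd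
    have hyh : 0 < y + h := by positivity
    rw [Real.exp_sub, Real.exp_log hyh, Real.exp_log hd0]
    exact hΨ d hd
  have hc₁ : Real.log (y + h₁) ≤ X + 1 := by simpa using hc 0
  have hc₂ : Real.log (y + h₂) ≤ X + 1 := by simpa using hc 1
  have hm₁ := norm_integral_psiFourier_eulerTrunc_sub_one_le hφ hψ hM hU₀ hX hX3 hc₁ hDN (hΨexp h₁ hΨ₁) hδ hbulk₁
    hC₀ hζ₀ hτ₀ hsmall hn
  have hm₂ := norm_integral_psiFourier_eulerTrunc_sub_one_le hφ hψ hM hU₀ hX hX3 hc₂ hDN (hΨexp h₂ hΨ₂) hδ hbulk₂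
    hC₀ hζ₀ hτ₀ hsmall hn
  have hm₁' : ‖(∫ τ : ℝ, psiFourier φ ψ X U₀ (Real.log (y + h₁)) τ * eulerTrunc N (zetaSlotS X τ)) - 1‖ ≤
      moebiusSlotErr M X U₀ C₀ τ₀ n := hm₁
  have hm₂' : ‖(∫ τ : ℝ, psiFourier φ ψ X U₀ (Real.log (y + h₂)) τ * eulerTrunc N (zetaSlotS X τ)) - 1‖ ≤
      moebiusSlotErr M X U₀ C₀ τ₀ n := hm₂
  have h := norm_integral_kernel_sub_le hφ hψ hU₀ hX h₁ h₂ hc N hKW herrW hK' hεK hm₁' hm₂'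
  exact h.trans (le_of_eq (by ring))

end TaoTeravainen

end Literature.Barriers.Parity
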